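import Summits.NavierStokesRegularity.NavierStokesRegularity.Theorems.ExtremiserTransienceNearExtremalTransienceExtremiserLiouvilleConstantSpeedSlabEnergySandwich
import Summits.NavierStokesRegularity.NavierStokesRegularity.Theorems.ExtremiserTransienceNearExtremalTransienceExtremiserLiouvilleConstantSpeedBlowDownConcentration
import HarnessLib

/-!
# Crux `ExtremiserTransience.NearExtremalTransience` (stmt-NavierStokesRegularity-21883), line `extremiser_liouville`,
# stub K1b — THE JET ALTERNATIVE HAS LINEAR EXCESS-ENERGY GROWTH (discharging the growth hypothesis of the blow-down theorems)

`--supports stmt-NavierStokesRegularity-21883` (helper).  Author: prover seat `ns-el-k1b` (g6).  The blow-down theorems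
(`blowDown_limit_ae_eq_zero`, `blowDown_not_stronglyConvergent`, `no_asymptoticallyHomogeneous_jet`) assume
`∫⁻_{B_ρ}‖v − c‖ₑ² ≤ C ρ` (`ρ ≥ 1`).  For the JET alternative of the axial dossier (slab energies finite, `H′`-window energies
`≡ E₀`) this follows from g5's slab-energy sandwich: `B_ρ ⊆ {−ρ ≤ x₂ ≤ ρ} ⊆ {s+1 ≤ x₂ ≤ s+N}` with `s = −ρ−1`, `N = ⌈2ρ⌉₊+2 ≤ 5ρ`.

* `inner_excess_eq_of_constSpeed` : `‖w‖ ≡ M = ‖c‖ ⇒ ⟪w x − c, c⟫ = −‖w x − c‖²/2` (pointwise; so `(w − c)·ĉ ≤ 0`).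
* `lintegral_ball_excess_sq_le_of_jet` : axial jet data ⇒ `∫⁻_{B_ρ}‖w − c‖ₑ² ≤ 5 E₀ ρ` for `ρ ≥ 1`.

WHAT THIS IS NOT: K1b is NOT proved; nothing here proves NS regularity. [folklore]
-/

noncomputable section

open Set Filter Topology MeasureTheory Metric Function
open scoped ENNReal NNReal Topology InnerProductSpace RealInnerProductSpace ContDiff
open Literature.Analysis.FluidPDE Literature.Analysis

namespace Summit.NavierStokesRegularity.NavierStokesRegularity.Theorems

-- the problem directory repeats the summit name (`NavierStokesRegularity/NavierStokesRegularity`)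
set_option linter.dupNamespace false

namespace ExtremiserLiouville

open DepletionLadder.KStar DepletionLadder.KStar.HalfSpace

variable {w : E3 → E3} {c : E3}

/-- **Constant speed makes the excess point backwards**: `‖w‖ ≡ M = ‖c‖ ⇒ ⟪w x − c, c⟫ = −‖w x − c‖²/2`. [folklore] -/
theorem inner_excess_eq_of_constSpeed {M : ℝ} (hM : ∀ x, ‖w x‖ = M) (hcM : ‖c‖ = M) (x : E3) :
    ⟪w x - c, c⟫_ℝ = -(‖w x - c‖ ^ 2 / 2) := by
  have h1 : ‖w x - c‖ ^ 2 = ‖w x‖ ^ 2 - 2 * ⟪w x, c⟫_ℝ + ‖c‖ ^ 2 := norm_sub_sq_real (w x) c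
  rw [inner_sub_left, real_inner_self_eq_norm_sq, h1, hM x, hcM]
  ring

/-- **Linear excess-energy growth of the axial jet**: for `w ∈ C¹` solenoidal of constant speed `M = ‖c‖` in the axial frame
(`c₀ = c₁ = 0 ≠ c₂`), with finite slab energies and `H′`-window energies `≡ E₀ ≥ 0`, one has `∫⁻_{B_ρ}‖w − c‖ₑ² ≤ 5 E₀ ρ` for every
`ρ ≥ 1`. [folklore] -/
theorem lintegral_ball_excess_sq_le_of_jet (hw : ContDiff ℝ 1 w) (hdiv : VectorCalculus.IsDivFree w) {M : ℝ}
    (hM : ∀ x, ‖w x‖ = M) (hcM : ‖c‖ = M) (hc0 : c 0 = 0) (hc1 : c 1 = 0) (hc2 : c 2 ≠ 0)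
    (hslab : ∀ T : ℝ, 0 < T → Integrable (fun x => {x : E3 | |x 2| ≤ T}.indicator (fun x => ‖w x - c‖ ^ 2) x) volume)
    {E₀ : ℝ} (hE0 : 0 ≤ E₀) (hE : ∀ s : ℝ, (∫ x, deriv Real.smoothTransition (x 2 - s) * ‖w x - c‖ ^ 2) = E₀)
    {ρ : ℝ} (hρ : 1 ≤ ρ) :
    ∫⁻ x in ball (0 : E3) ρ, ‖w x - c‖ₑ ^ 2 ≤ ENNReal.ofReal (5 * E₀ * ρ) := by
  set V : E3 → E3 := fun x => w x - c with hVdef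
  have hV : ContDiff ℝ 1 V := hw.sub contDiff_const
  have hVdiv : VectorCalculus.IsDivFree V := by
    intro x
    have h := hdiv x
    simp only [VectorCalculus.divergence] at h ⊢
    rw [hVdef]
    rw [show (fun x => w x - c) = fun x => w x - c from rfl, fderiv_sub_const]
    exact h
  have hVc : ∀ x, ⟪V x, c⟫_ℝ = -(‖V x‖ ^ 2 / 2) := fun x => inner_excess_eq_of_constSpeed hM hcM x
  -- the slab `[s+1, s+N] ⊇ [−ρ, ρ]`
  set N : ℕ := ⌈2 * ρ⌉₊ + 2 with hN
  set s : ℝ := -ρ - 1 with hs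
  have hN1 : 2 * ρ + 2 ≤ (N : ℝ) := by
    have h := Nat.le_ceil (2 * ρ)
    simp only [hN, Nat.cast_add, Nat.cast_ofNat]
    linarith
  have hN2 : (N : ℝ) ≤ 5 * ρ := by
    have h := (Nat.ceil_lt_add_one (by linarith : (0 : ℝ) ≤ 2 * ρ)).le
    simp only [hN, Nat.cast_add, Nat.cast_ofNat]
    linarith
  set T : ℝ := |s| + N + 2 with hT
  have hT0 : 0 < T := by rw [hT]; positivity
  have hsand := (slabEnergy_sandwich_of_windowEnergy hV hVdiv hVc hc0 hc1 hc2 (T := T) (s := s) (N := N) le_rfl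
    (hslab T hT0) (E₀ := E₀) (fun u _ => hE u)).1
  -- `∫⁻_{B_ρ} ≤ ∫ 1_{slab}`
  have hsub : ball (0 : E3) ρ ⊆ {x : E3 | s + 1 ≤ x 2 ∧ x 2 ≤ s + N} := by
    intro x hx
    rw [mem_ball_zero_iff] at hx
    have h2 : |x 2| ≤ ‖x‖ := by
      have h := EuclideanSpace.norm_eq x ▸ Real.sqrt_le_sqrt (Finset.single_le_sum (fun i _ => sq_nonneg ‖x i‖) (Finset.mem_univ (2 : Fin 3)))
      rw [Real.sqrt_sq (norm_nonneg _)] at h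
      rw [← Real.norm_eq_abs]; exact h
    rw [abs_le] at h2
    refine ⟨by rw [hs]; linarith [h2.1], by rw [hs]; linarith [h2.2]⟩
  have hint := integrable_indicator_slab_mul_sq hV.continuous (T := T) (a := s + 1) (b := s + N)
    (by rw [hT]; linarith [abs_nonneg s, neg_abs_le s]) (by rw [hT]; linarith [le_abs_self s]) (hslab T hT0)
  calc ∫⁻ x in ball (0 : E3) ρ, ‖w x - c‖ₑ ^ 2
      ≤ ∫⁻ x in {x : E3 | s + 1 ≤ x 2 ∧ x 2 ≤ s + N}, ‖V x‖ₑ ^ 2 := lintegral_mono_set hsub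
    _ = ∫⁻ x, ENNReal.ofReal ({x : E3 | s + 1 ≤ x 2 ∧ x 2 ≤ s + N}.indicator (fun x => ‖V x‖ ^ 2) x) := by
        rw [← lintegral_indicator (measurableSet_slab _ _)]
        refine lintegral_congr fun x => ?_
        by_cases hx : x ∈ {x : E3 | s + 1 ≤ x 2 ∧ x 2 ≤ s + N}
        · rw [indicator_of_mem hx, indicator_of_mem hx, ← ofReal_norm, ← ENNReal.ofReal_pow (norm_nonneg _)]
        · rw [indicator_of_notMem hx, indicator_of_notMem hx, ENNReal.ofReal_zero]
    _ = ENNReal.ofReal (∫ x, {x : E3 | s + 1 ≤ x 2 ∧ x 2 ≤ s + N}.indicator (fun x => ‖V x‖ ^ 2) x) := by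
        rw [ofReal_integral_eq_lintegral_ofReal hint (Eventually.of_forall fun x =>
          indicator_nonneg (fun _ _ => sq_nonneg _) _)]
    _ ≤ ENNReal.ofReal (N * E₀) := ENNReal.ofReal_le_ofReal hsand
    _ ≤ ENNReal.ofReal (5 * E₀ * ρ) := ENNReal.ofReal_le_ofReal (by nlinarith)

end ExtremiserLiouville

end Summit.NavierStokesRegularity.NavierStokesRegularity.Theorems

end
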